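import Summits.NavierStokesRegularity.NavierStokesRegularity.Theorems.LerayQuarterDissipationFiniteDissipationLiouvilleTraceInfinity
import Summits.NavierStokesRegularity.NavierStokesRegularity.Theorems.LerayQuarterDissipationFiniteDissipationLiouvilleTraceSupport
import HarnessLib

/-!
# Crux `FiniteDissipationLiouville` (stmt-NavierStokesRegularity-22144): ONE-SCALE ε-REGULARITY
# IN TERMS OF THE FINAL DATUM, WITH A THRESHOLD DEPENDING ONLY ON `(C, K)` — at the apex and at
# spatial infinity

Theorems file of route `LerayQuarterDissipation` (lead prover g5; `--supports` the crux: uniform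
forms of the apex / infinity trace leaves, for EVERY member of the stratum — past-DSS or
past-wandering). Navier–Stokes regularity is NOT proved by anything here; no summit is.

`𝒟_{C,K}`: Type-I ancient mild fields `u` (`IsTypeIAncientMild C u`) with the quarter-rate law;
`T_u(ψ) = lim_{t→0⁻} ∫⟪u(t), ψ⟫` the distributional trace at the singular time (lead g3). The
leaves `…TraceApex` / `…TraceInfinity` (this lead) are qualitative: vanishing `L³`-concentration of
the trace at the apex (for EVERY `ε` some scale `ρ`), resp. at infinity, forces regularity. The
dual `L³`-quantity `sup_{ψ ⊂ B(0,ρ)} |T_u(ψ)| / ‖ψ‖_{L^{3/2}}` is INVARIANT under the Navier–Stokes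
dilations (`T_{u_λ}(ψ) = λ⁻² T_u(ψ(λ⁻¹·))`, `‖ψ(λ⁻¹·)‖_{L^{3/2}} = λ²‖ψ‖_{L^{3/2}}`), and so is the
stratum; compactness across members then makes the threshold UNIFORM:

* `exists_trace_epsilon_apex` — **ONE-SCALE ε-REGULARITY AT THE FINAL TIME**: for all `C, K`
  there is `ε₀ = ε₀(C,K) > 0` such that every member `u ∈ 𝒟_{C,K}` whose trace satisfies
  `|T_u(ψ)| ≤ ε₀ ‖ψ‖_{L^{3/2}}` for all test fields `ψ` supported in ONE ball `B(0, ρ)` is regular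
  at the apex. (For traces that are functions: `‖u₀‖_{L³(B(0,ρ))} ≤ ε₀` at one scale ⇒ regular —
  Caffarelli–Kohn–Nirenberg's one-scale criterion, but read off the FINAL DATUM alone.) Proof:
  rescale `ρ` to `1`; a sequence of singular members with thresholds `1/(k+1)` has, by KNSS
  compactness (p1) and persistence of the apex singularity, a singular limit member whose trace
  VANISHES ON `B(0,1)` (trace continuity, lead g3), hence is bounded near the apex — regular by
  `not_singular_of_trace_locallyBounded` (`…TraceApex`): contradiction.
* `exists_trace_epsilon_atInfinity` — **ONE-SCALE ε-REGULARITY FROM SPATIAL INFINITY**: for all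
  `C, K` there is `ε₁ = ε₁(C,K) > 0` such that every member whose trace satisfies
  `|T_u(ψ)| ≤ ε₁ ‖ψ‖_{L^{3/2}}` for all test fields supported OUTSIDE ONE ball `B(0, R)` is regular
  at the apex. Proof: rescale `R` to `1`; the singular limit member has trace vanishing outside
  `B̄(0,1)`, hence is `≡ 0` by BACKWARD UNIQUENESS FROM SPATIAL INFINITY (`…TraceSupport`,
  far-field form of Lemarié-Rieusset Thm. 15.4): contradiction.
* PORTRAIT (`trace_L3_apex_floor_of_singular`, `trace_L3_farField_floor_of_singular`): **the final
  datum of a SINGULAR member of `𝒟_{C,K}` carries dual-`L³` mass `> ε₀(C,K)` in EVERY ball around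
  the apex and `> ε₁(C,K)` outside EVERY ball** — uniform, scale-free floors, the final-datum
  analogue of the `L³`-concentration `ε₀³r²` of the space-time CKN quantity at a singular point
  (lead g4 `…ApexEpsilon`) and of the instantaneous floors of seat ns-lqd-p2 (`…QuietSlice`,
  `…QuietCore`). HONEST FRAMING: `ε₀, ε₁` come from compactness, not explicit; no DSS scenario of
  the wall is removed (portrait facts for both stubs).

References: Caffarelli–Kohn–Nirenberg, CPAM 35 (1982); Koch–Nadirashvili–Seregin–Šverák, Acta
Math. 203 (2009), §4; Albritton–Barker, arXiv:1811.00502, Prop. 2.3; Lemarié-Rieusset (2016),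
Thm. 15.4.
-/

noncomputable section

-- the summit and its single sub-problem share the name (CONVENTIONS §1), as in every Theorems file
set_option linter.dupNamespace false

namespace Summit.NavierStokesRegularity.NavierStokesRegularity.Theorems.FiniteDissipationLiouville.Birth.Apex

open MeasureTheory Set Filter Topology Metric Function TopologicalSpace
open Literature.Analysis Literature.Analysis.FluidPDE
open scoped ENNReal NNReal RealInnerProductSpace

variable {C K : ℝ} {u : ℝ → EuclideanSpace ℝ (Fin 3) → EuclideanSpace ℝ (Fin 3)}

/-! ### Scale invariance of the dual `L³` smallness of the trace -/

/-- **The dual-`L³` smallness of the trace on a ball is dilation invariant (normalisation to the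
unit ball).** If `|T_u(ψ)| ≤ ε ‖ψ‖_{L^{3/2}}` for the test fields supported in `B(0, ρ)`, then the
dilate `u_ρ = nsRescale ρ u` satisfies the same with `B(0, 1)`. -/
theorem trace_L3small_ball_nsRescale (hu : IsTypeIAncientMild C u)
    (hlaw : ∀ s : ℝ, s < 0 → ∫⁻ x, ‖fderiv ℝ (u s) x‖ₑ ^ 2 ≤ ENNReal.ofReal (K / Real.sqrt (-s)))
    {ρ ε : ℝ} (hρ : 0 < ρ)
    (hsmall : ∀ ψ : EuclideanSpace ℝ (Fin 3) → EuclideanSpace ℝ (Fin 3),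
      FunctionSpaces.IsTestFunctionOn (⊤ : Opens (EuclideanSpace ℝ (Fin 3))) ψ →
      (∀ x, ψ x ≠ 0 → ‖x‖ < ρ) →
      ∀ T : ℝ, Tendsto (fun t => ∫ x, ⟪u t x, ψ x⟫) (𝓝[<] 0) (𝓝 T) →
        |T| ≤ ε * (∫ x, ‖ψ x‖ ^ (3 / 2 : ℝ)) ^ (2 / 3 : ℝ)) :
    ∀ ψ : EuclideanSpace ℝ (Fin 3) → EuclideanSpace ℝ (Fin 3),
      FunctionSpaces.IsTestFunctionOn (⊤ : Opens (EuclideanSpace ℝ (Fin 3))) ψ →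
      (∀ x, ψ x ≠ 0 → ‖x‖ < 1) →
      ∀ T : ℝ, Tendsto (fun t => ∫ x, ⟪nsRescale ρ u t x, ψ x⟫) (𝓝[<] 0) (𝓝 T) →
        |T| ≤ ε * (∫ x, ‖ψ x‖ ^ (3 / 2 : ℝ)) ^ (2 / 3 : ℝ) := by
  intro ψ hψ hsupp T hT
  -- the trace of `u` against the dilated field, and the identification `T = ρ⁻² T'`
  obtain ⟨T', hT'⟩ := exists_tendsto_pairing_finalSlice hu hlaw
    (hψ.comp_smul_top (inv_ne_zero hρ.ne'))
  have hTv := tendsto_pairing_nsRescale (w := u) hρ hT'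
  have hTeq : T = (ρ ^ 2)⁻¹ * T' := tendsto_nhds_unique hT hTv
  -- the smallness for the dilated field (supported in `B(0, ρ)`)
  have hsupp' : ∀ x, ψ (ρ⁻¹ • x) ≠ 0 → ‖x‖ < ρ := fun x hx => by
    have h := support_comp_inv_smul hρ hsupp x hx
    rwa [mul_one] at h
  have h := hsmall _ (hψ.comp_smul_top (inv_ne_zero hρ.ne')) hsupp' T' hT'
  rw [integral_comp_inv_smul_eq (g := fun x => ‖ψ x‖ ^ (3 / 2 : ℝ)) hρ] at h
  set I : ℝ := ∫ x, ‖ψ x‖ ^ (3 / 2 : ℝ) with hI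
  have hI0 : 0 ≤ I := integral_nonneg fun _ => Real.rpow_nonneg (norm_nonneg _) _
  have hpow : (ρ ^ 3 * I) ^ (2 / 3 : ℝ) = ρ ^ 2 * I ^ (2 / 3 : ℝ) := by
    rw [Real.mul_rpow (pow_nonneg hρ.le 3) hI0]
    congr 1
    rw [← Real.rpow_natCast ρ 3, ← Real.rpow_mul hρ.le]
    norm_num
  rw [hpow] at h
  have hρ2 : 0 < ρ ^ 2 := by positivity
  -- `ε ≥ 0` unless the bound is vacuous; treat via the absolute value directly
  rw [hTeq, abs_mul, abs_of_pos (inv_pos.2 hρ2)]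
  calc (ρ ^ 2)⁻¹ * |T'| ≤ (ρ ^ 2)⁻¹ * (ε * (ρ ^ 2 * I ^ (2 / 3 : ℝ))) :=
        mul_le_mul_of_nonneg_left h (inv_nonneg.2 hρ2.le)
    _ = ε * I ^ (2 / 3 : ℝ) := by field_simp

/-- **The dual-`L³` smallness of the trace outside a ball is dilation invariant (normalisation to
the unit ball).** If `|T_u(ψ)| ≤ ε ‖ψ‖_{L^{3/2}}` for the test fields supported in `{|x| > R}`, then
`u_R = nsRescale R u` satisfies the same with `{|x| > 1}`. -/
theorem trace_L3small_farField_nsRescale (hu : IsTypeIAncientMild C u)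
    (hlaw : ∀ s : ℝ, s < 0 → ∫⁻ x, ‖fderiv ℝ (u s) x‖ₑ ^ 2 ≤ ENNReal.ofReal (K / Real.sqrt (-s)))
    {R ε : ℝ} (hR : 0 < R)
    (hsmall : ∀ ψ : EuclideanSpace ℝ (Fin 3) → EuclideanSpace ℝ (Fin 3),
      FunctionSpaces.IsTestFunctionOn (⊤ : Opens (EuclideanSpace ℝ (Fin 3))) ψ →
      (∀ x, ψ x ≠ 0 → R < ‖x‖) →
      ∀ T : ℝ, Tendsto (fun t => ∫ x, ⟪u t x, ψ x⟫) (𝓝[<] 0) (𝓝 T) →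
        |T| ≤ ε * (∫ x, ‖ψ x‖ ^ (3 / 2 : ℝ)) ^ (2 / 3 : ℝ)) :
    ∀ ψ : EuclideanSpace ℝ (Fin 3) → EuclideanSpace ℝ (Fin 3),
      FunctionSpaces.IsTestFunctionOn (⊤ : Opens (EuclideanSpace ℝ (Fin 3))) ψ →
      (∀ x, ψ x ≠ 0 → 1 < ‖x‖) →
      ∀ T : ℝ, Tendsto (fun t => ∫ x, ⟪nsRescale R u t x, ψ x⟫) (𝓝[<] 0) (𝓝 T) →
        |T| ≤ ε * (∫ x, ‖ψ x‖ ^ (3 / 2 : ℝ)) ^ (2 / 3 : ℝ) := by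
  intro ψ hψ hsupp T hT
  obtain ⟨T', hT'⟩ := exists_tendsto_pairing_finalSlice hu hlaw
    (hψ.comp_smul_top (inv_ne_zero hR.ne'))
  have hTv := tendsto_pairing_nsRescale (w := u) hR hT'
  have hTeq : T = (R ^ 2)⁻¹ * T' := tendsto_nhds_unique hT hTv
  -- the dilated field is supported in `{|x| > R}`
  have hsupp' : ∀ x, ψ (R⁻¹ • x) ≠ 0 → R < ‖x‖ := fun x hx => by
    have h := hsupp _ hx
    rw [norm_smul, norm_inv, Real.norm_of_nonneg hR.le] at h
    rwa [lt_inv_mul_iff₀ hR, mul_one] at h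
  have h := hsmall _ (hψ.comp_smul_top (inv_ne_zero hR.ne')) hsupp' T' hT'
  rw [integral_comp_inv_smul_eq (g := fun x => ‖ψ x‖ ^ (3 / 2 : ℝ)) hR] at h
  set I : ℝ := ∫ x, ‖ψ x‖ ^ (3 / 2 : ℝ) with hI
  have hI0 : 0 ≤ I := integral_nonneg fun _ => Real.rpow_nonneg (norm_nonneg _) _
  have hpow : (R ^ 3 * I) ^ (2 / 3 : ℝ) = R ^ 2 * I ^ (2 / 3 : ℝ) := by
    rw [Real.mul_rpow (pow_nonneg hR.le 3) hI0]
    congr 1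
    rw [← Real.rpow_natCast R 3, ← Real.rpow_mul hR.le]
    norm_num
  rw [hpow] at h
  have hR2 : 0 < R ^ 2 := by positivity
  rw [hTeq, abs_mul, abs_of_pos (inv_pos.2 hR2)]
  calc (R ^ 2)⁻¹ * |T'| ≤ (R ^ 2)⁻¹ * (ε * (R ^ 2 * I ^ (2 / 3 : ℝ))) :=
        mul_le_mul_of_nonneg_left h (inv_nonneg.2 hR2.le)
    _ = ε * I ^ (2 / 3 : ℝ) := by field_simp

/-! ### One-scale ε-regularity at the final time, uniform threshold -/

/-- **ONE-SCALE ε-REGULARITY IN TERMS OF THE FINAL DATUM, threshold depending on `(C, K)` only.**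
For all `C, K` there is `ε₀ > 0` such that: if `u ∈ 𝒟_{C,K}` and, for SOME `ρ > 0`, every test
field `ψ` supported in `B(0, ρ)` has trace value `|T_u(ψ)| ≤ ε₀ ‖ψ‖_{L^{3/2}}`, then `u` is NOT
singular at the apex. -/
theorem exists_trace_epsilon_apex (C K : ℝ) : ∃ ε₀ > 0,
    ∀ (u : ℝ → EuclideanSpace ℝ (Fin 3) → EuclideanSpace ℝ (Fin 3)),
      IsTypeIAncientMild C u →
      (∀ s : ℝ, s < 0 → ∫⁻ x, ‖fderiv ℝ (u s) x‖ₑ ^ 2 ≤ ENNReal.ofReal (K / Real.sqrt (-s))) →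
      ∀ ρ > 0,
      (∀ ψ : EuclideanSpace ℝ (Fin 3) → EuclideanSpace ℝ (Fin 3),
        FunctionSpaces.IsTestFunctionOn (⊤ : Opens (EuclideanSpace ℝ (Fin 3))) ψ →
        (∀ x, ψ x ≠ 0 → ‖x‖ < ρ) →
        ∀ T : ℝ, Tendsto (fun t => ∫ x, ⟪u t x, ψ x⟫) (𝓝[<] 0) (𝓝 T) →
          |T| ≤ ε₀ * (∫ x, ‖ψ x‖ ^ (3 / 2 : ℝ)) ^ (2 / 3 : ℝ)) →
      ¬ (∀ r > 0, ∀ M : ℝ, ∃ t ∈ Set.Ioo (-(r ^ 2)) (0 : ℝ),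
          ∃ x ∈ Metric.ball (0 : EuclideanSpace ℝ (Fin 3)) r, M < ‖u t x‖) := by
  by_contra hcon
  push Not at hcon
  -- ### a sequence of singular members, small at one scale with threshold `1/(k+1)`
  have hseq : ∀ k : ℕ, ∃ (v : ℝ → EuclideanSpace ℝ (Fin 3) → EuclideanSpace ℝ (Fin 3)),
      IsTypeIAncientMild C v ∧
      (∀ s : ℝ, s < 0 → ∫⁻ x, ‖fderiv ℝ (v s) x‖ₑ ^ 2 ≤ ENNReal.ofReal (K / Real.sqrt (-s))) ∧
      (∀ ψ : EuclideanSpace ℝ (Fin 3) → EuclideanSpace ℝ (Fin 3),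
        FunctionSpaces.IsTestFunctionOn (⊤ : Opens (EuclideanSpace ℝ (Fin 3))) ψ →
        (∀ x, ψ x ≠ 0 → ‖x‖ < 1) →
        ∀ T : ℝ, Tendsto (fun t => ∫ x, ⟪v t x, ψ x⟫) (𝓝[<] 0) (𝓝 T) →
          |T| ≤ 1 / ((k : ℝ) + 1) * (∫ x, ‖ψ x‖ ^ (3 / 2 : ℝ)) ^ (2 / 3 : ℝ)) ∧
      (∀ r > 0, ∀ M : ℝ, ∃ t ∈ Set.Ioo (-(r ^ 2)) (0 : ℝ),
          ∃ x ∈ Metric.ball (0 : EuclideanSpace ℝ (Fin 3)) r, M < ‖v t x‖) := by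
    intro k
    obtain ⟨u, hu, hlaw, ρ, hρ, hsmall, hsing⟩ := hcon (1 / ((k : ℝ) + 1)) (by positivity)
    exact ⟨nsRescale ρ u, hu.nsRescale hρ, RecurrentReductionD.dissipationLaw_nsRescale hlaw hρ,
      trace_L3small_ball_nsRescale hu hlaw hρ hsmall,
      RecurrentReductionD.singularAtOrigin_nsRescale hsing hρ⟩
  choose v hv hvlaw hvsmall hvsing using hseq
  -- ### KNSS compactness across members: a singular limit member `W ∈ 𝒟_{C,K}`
  obtain ⟨ψs, hψs, W, hW, hunif, hpt, hgrad⟩ := Compactness.seqLimit hv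
  have hψt : Tendsto ψs atTop atTop := hψs.tendsto_atTop
  have hWlaw : ∀ s : ℝ, s < 0 →
      ∫⁻ x, ‖fderiv ℝ (W s) x‖ₑ ^ 2 ≤ ENNReal.ofReal (K / Real.sqrt (-s)) :=
    Compactness.law_of_seqLimit (Kinf := K) (Kk := fun _ => K) hψt hvlaw
      (fun ε hε => Eventually.of_forall fun _ => by linarith) hgrad
  have hWsing := Compactness.persistent_singularity_seq (w := fun j => v (ψs j))
    (fun j => hv (ψs j)) (fun j => hvlaw (ψs j)) (fun j => hvsing (ψs j)) hW hunif
  -- ### the trace of `W` vanishes on `B(0, 1)`: it is "bounded by `0`" there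
  refine not_singular_of_trace_locallyBounded hW hWlaw one_pos (M := 0) (fun φ hφ hsupp L hL => ?_)
    hWsing
  rw [zero_mul]
  -- trace values of the approximants against `φ`
  have hex : ∀ j, ∃ Tj : ℝ, Tendsto (fun t => ∫ x, ⟪v (ψs j) t x, φ x⟫) (𝓝[<] 0) (𝓝 Tj) :=
    fun j => exists_tendsto_pairing_finalSlice (hv (ψs j)) (hvlaw (ψs j)) hφ
  choose Tj hTj using hex
  have hconv : Tendsto Tj atTop (𝓝 L) :=
    tendsto_trace_of_tendsto_slices hφ (fun j => hv (ψs j)) (fun j => hvlaw (ψs j)) hW hWlaw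
      (fun t ht x => hpt t ht x) hTj hL
  set I : ℝ := (∫ x, ‖φ x‖ ^ (3 / 2 : ℝ)) ^ (2 / 3 : ℝ) with hI
  have hbound : ∀ j, |Tj j| ≤ 1 / ((ψs j : ℝ) + 1) * I := fun j =>
    hvsmall (ψs j) φ hφ hsupp (Tj j) (hTj j)
  have hzero : Tendsto Tj atTop (𝓝 0) := by
    have hmaj : Tendsto (fun j => 1 / ((ψs j : ℝ) + 1) * I) atTop (𝓝 0) := by
      have h1 : Tendsto (fun j => 1 / ((ψs j : ℝ) + 1)) atTop (𝓝 0) := by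
        have h2 : Tendsto (fun j => (ψs j : ℝ) + 1) atTop atTop :=
          tendsto_atTop_add_const_right _ _ (tendsto_natCast_atTop_atTop.comp hψt)
        exact tendsto_const_nhds.div_atTop h2
      simpa using h1.mul_const I
    exact squeeze_zero_norm (fun j => by rw [Real.norm_eq_abs]; exact hbound j) hmaj
  have hL0 : L = 0 := tendsto_nhds_unique hconv hzero
  rw [hL0, abs_zero]

/-- **ONE-SCALE ε-REGULARITY FROM SPATIAL INFINITY, threshold depending on `(C, K)` only.** For
all `C, K` there is `ε₁ > 0` such that: if `u ∈ 𝒟_{C,K}` and, for SOME `R > 0`, every test field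
`ψ` supported in `{|x| > R}` has trace value `|T_u(ψ)| ≤ ε₁ ‖ψ‖_{L^{3/2}}`, then `u` is NOT singular
at the apex. The singular limit produced by compactness has a trace vanishing outside the unit
ball, which backward uniqueness from spatial infinity (`…TraceSupport`) forbids. -/
theorem exists_trace_epsilon_atInfinity (C K : ℝ) : ∃ ε₁ > 0,
    ∀ (u : ℝ → EuclideanSpace ℝ (Fin 3) → EuclideanSpace ℝ (Fin 3)),
      IsTypeIAncientMild C u →
      (∀ s : ℝ, s < 0 → ∫⁻ x, ‖fderiv ℝ (u s) x‖ₑ ^ 2 ≤ ENNReal.ofReal (K / Real.sqrt (-s))) →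
      ∀ R > 0,
      (∀ ψ : EuclideanSpace ℝ (Fin 3) → EuclideanSpace ℝ (Fin 3),
        FunctionSpaces.IsTestFunctionOn (⊤ : Opens (EuclideanSpace ℝ (Fin 3))) ψ →
        (∀ x, ψ x ≠ 0 → R < ‖x‖) →
        ∀ T : ℝ, Tendsto (fun t => ∫ x, ⟪u t x, ψ x⟫) (𝓝[<] 0) (𝓝 T) →
          |T| ≤ ε₁ * (∫ x, ‖ψ x‖ ^ (3 / 2 : ℝ)) ^ (2 / 3 : ℝ)) →
      ¬ (∀ r > 0, ∀ M : ℝ, ∃ t ∈ Set.Ioo (-(r ^ 2)) (0 : ℝ),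
          ∃ x ∈ Metric.ball (0 : EuclideanSpace ℝ (Fin 3)) r, M < ‖u t x‖) := by
  by_contra hcon
  push Not at hcon
  have hseq : ∀ k : ℕ, ∃ (v : ℝ → EuclideanSpace ℝ (Fin 3) → EuclideanSpace ℝ (Fin 3)),
      IsTypeIAncientMild C v ∧
      (∀ s : ℝ, s < 0 → ∫⁻ x, ‖fderiv ℝ (v s) x‖ₑ ^ 2 ≤ ENNReal.ofReal (K / Real.sqrt (-s))) ∧
      (∀ ψ : EuclideanSpace ℝ (Fin 3) → EuclideanSpace ℝ (Fin 3),
        FunctionSpaces.IsTestFunctionOn (⊤ : Opens (EuclideanSpace ℝ (Fin 3))) ψ →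
        (∀ x, ψ x ≠ 0 → 1 < ‖x‖) →
        ∀ T : ℝ, Tendsto (fun t => ∫ x, ⟪v t x, ψ x⟫) (𝓝[<] 0) (𝓝 T) →
          |T| ≤ 1 / ((k : ℝ) + 1) * (∫ x, ‖ψ x‖ ^ (3 / 2 : ℝ)) ^ (2 / 3 : ℝ)) ∧
      (∀ r > 0, ∀ M : ℝ, ∃ t ∈ Set.Ioo (-(r ^ 2)) (0 : ℝ),
          ∃ x ∈ Metric.ball (0 : EuclideanSpace ℝ (Fin 3)) r, M < ‖v t x‖) := by
    intro k
    obtain ⟨u, hu, hlaw, R, hR, hsmall, hsing⟩ := hcon (1 / ((k : ℝ) + 1)) (by positivity)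
    exact ⟨nsRescale R u, hu.nsRescale hR, RecurrentReductionD.dissipationLaw_nsRescale hlaw hR,
      trace_L3small_farField_nsRescale hu hlaw hR hsmall,
      RecurrentReductionD.singularAtOrigin_nsRescale hsing hR⟩
  choose v hv hvlaw hvsmall hvsing using hseq
  obtain ⟨ψs, hψs, W, hW, hunif, hpt, hgrad⟩ := Compactness.seqLimit hv
  have hψt : Tendsto ψs atTop atTop := hψs.tendsto_atTop
  have hWlaw : ∀ s : ℝ, s < 0 →
      ∫⁻ x, ‖fderiv ℝ (W s) x‖ₑ ^ 2 ≤ ENNReal.ofReal (K / Real.sqrt (-s)) :=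
    Compactness.law_of_seqLimit (Kinf := K) (Kk := fun _ => K) hψt hvlaw
      (fun ε hε => Eventually.of_forall fun _ => by linarith) hgrad
  have hWsing := Compactness.persistent_singularity_seq (w := fun j => v (ψs j))
    (fun j => hv (ψs j)) (fun j => hvlaw (ψs j)) (fun j => hvsing (ψs j)) hW hunif
  -- ### the trace of `W` vanishes outside `B̄(0, 1)`: backward uniqueness from infinity
  refine notSingular_of_trace_farField_vanishing hW hWlaw (R₁ := 1) (fun φ hφ hsupp => ?_) hWsing
  obtain ⟨L, hL⟩ := exists_tendsto_pairing_finalSlice hW hWlaw hφ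
  suffices hL0 : L = 0 by rwa [hL0] at hL
  have hex : ∀ j, ∃ Tj : ℝ, Tendsto (fun t => ∫ x, ⟪v (ψs j) t x, φ x⟫) (𝓝[<] 0) (𝓝 Tj) :=
    fun j => exists_tendsto_pairing_finalSlice (hv (ψs j)) (hvlaw (ψs j)) hφ
  choose Tj hTj using hex
  have hconv : Tendsto Tj atTop (𝓝 L) :=
    tendsto_trace_of_tendsto_slices hφ (fun j => hv (ψs j)) (fun j => hvlaw (ψs j)) hW hWlaw
      (fun t ht x => hpt t ht x) hTj hL
  set I : ℝ := (∫ x, ‖φ x‖ ^ (3 / 2 : ℝ)) ^ (2 / 3 : ℝ) with hI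
  have hbound : ∀ j, |Tj j| ≤ 1 / ((ψs j : ℝ) + 1) * I := fun j =>
    hvsmall (ψs j) φ hφ hsupp (Tj j) (hTj j)
  have hzero : Tendsto Tj atTop (𝓝 0) := by
    have hmaj : Tendsto (fun j => 1 / ((ψs j : ℝ) + 1) * I) atTop (𝓝 0) := by
      have h1 : Tendsto (fun j => 1 / ((ψs j : ℝ) + 1)) atTop (𝓝 0) := by
        have h2 : Tendsto (fun j => (ψs j : ℝ) + 1) atTop atTop :=
          tendsto_atTop_add_const_right _ _ (tendsto_natCast_atTop_atTop.comp hψt)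
        exact tendsto_const_nhds.div_atTop h2
      simpa using h1.mul_const I
    exact squeeze_zero_norm (fun j => by rw [Real.norm_eq_abs]; exact hbound j) hmaj
  exact tendsto_nhds_unique hconv hzero

/-! ### Portrait: uniform dual-`L³` floors of the final datum of a singular member -/

/-- **PORTRAIT ENTRY (both stubs): uniform `L³`-floor at the apex.** There is `ε₀ = ε₀(C,K) > 0`
such that the final datum of every SINGULAR member of `𝒟_{C,K}` has, in EVERY ball `B(0, ρ)`, a
test field `ψ` with `|T_u(ψ)| > ε₀ ‖ψ‖_{L^{3/2}}`. -/
theorem trace_L3_apex_floor_of_singular (C K : ℝ) : ∃ ε₀ > 0,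
    ∀ (u : ℝ → EuclideanSpace ℝ (Fin 3) → EuclideanSpace ℝ (Fin 3)),
      IsTypeIAncientMild C u →
      (∀ s : ℝ, s < 0 → ∫⁻ x, ‖fderiv ℝ (u s) x‖ₑ ^ 2 ≤ ENNReal.ofReal (K / Real.sqrt (-s))) →
      (∀ r > 0, ∀ M : ℝ, ∃ t ∈ Set.Ioo (-(r ^ 2)) (0 : ℝ),
          ∃ x ∈ Metric.ball (0 : EuclideanSpace ℝ (Fin 3)) r, M < ‖u t x‖) →
      ∀ ρ > 0, ∃ (ψ : EuclideanSpace ℝ (Fin 3) → EuclideanSpace ℝ (Fin 3)) (T : ℝ),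
        FunctionSpaces.IsTestFunctionOn (⊤ : Opens (EuclideanSpace ℝ (Fin 3))) ψ ∧
          (∀ x, ψ x ≠ 0 → ‖x‖ < ρ) ∧
          Tendsto (fun t => ∫ x, ⟪u t x, ψ x⟫) (𝓝[<] 0) (𝓝 T) ∧
          ε₀ * (∫ x, ‖ψ x‖ ^ (3 / 2 : ℝ)) ^ (2 / 3 : ℝ) < |T| := by
  obtain ⟨ε₀, hε₀, h⟩ := exists_trace_epsilon_apex C K
  refine ⟨ε₀, hε₀, fun u hu hlaw hsing ρ hρ => ?_⟩
  by_contra hno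
  push Not at hno
  exact h u hu hlaw ρ hρ (fun ψ hψ hs T hT => hno ψ T hψ hs hT) hsing

/-- **PORTRAIT ENTRY (both stubs): uniform `L³`-floor at infinity.** There is `ε₁ = ε₁(C,K) > 0`
such that the final datum of every SINGULAR member of `𝒟_{C,K}` has, outside EVERY ball
`B(0, R)`, a test field `ψ` with `|T_u(ψ)| > ε₁ ‖ψ‖_{L^{3/2}}`. -/
theorem trace_L3_farField_floor_of_singular (C K : ℝ) : ∃ ε₁ > 0,
    ∀ (u : ℝ → EuclideanSpace ℝ (Fin 3) → EuclideanSpace ℝ (Fin 3)),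
      IsTypeIAncientMild C u →
      (∀ s : ℝ, s < 0 → ∫⁻ x, ‖fderiv ℝ (u s) x‖ₑ ^ 2 ≤ ENNReal.ofReal (K / Real.sqrt (-s))) →
      (∀ r > 0, ∀ M : ℝ, ∃ t ∈ Set.Ioo (-(r ^ 2)) (0 : ℝ),
          ∃ x ∈ Metric.ball (0 : EuclideanSpace ℝ (Fin 3)) r, M < ‖u t x‖) →
      ∀ R > 0, ∃ (ψ : EuclideanSpace ℝ (Fin 3) → EuclideanSpace ℝ (Fin 3)) (T : ℝ),
        FunctionSpaces.IsTestFunctionOn (⊤ : Opens (EuclideanSpace ℝ (Fin 3))) ψ ∧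
          (∀ x, ψ x ≠ 0 → R < ‖x‖) ∧
          Tendsto (fun t => ∫ x, ⟪u t x, ψ x⟫) (𝓝[<] 0) (𝓝 T) ∧
          ε₁ * (∫ x, ‖ψ x‖ ^ (3 / 2 : ℝ)) ^ (2 / 3 : ℝ) < |T| := by
  obtain ⟨ε₁, hε₁, h⟩ := exists_trace_epsilon_atInfinity C K
  refine ⟨ε₁, hε₁, fun u hu hlaw hsing R hR => ?_⟩
  by_contra hno
  push Not at hno
  exact h u hu hlaw R hR (fun ψ hψ hs T hT => hno ψ T hψ hs hT) hsing

end Summit.NavierStokesRegularity.NavierStokesRegularity.Theorems.FiniteDissipationLiouville.Birth.Apex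

end
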